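import Mathlib
import Summits.ValiantsHypothesis.ValiantsHypothesis.Theorems.LacunarySymmetroidMatrixDescartesCensusWindowFourPocketTwist
import Summits.ValiantsHypothesis.ValiantsHypothesis.Theorems.LacunarySymmetroidMatrixDescartesCensusWindowFourBandLaw
import Summits.ValiantsHypothesis.ValiantsHypothesis.Theorems.LacunarySymmetroidMatrixDescartesCensusWindowFourWitnessParam

/-!
# `MatrixDescartes` census — WINDOW-4 POCKET ROWS II: the local-min / local-max characterisation WITH MULTIPLICITY (KEY)

HONEST FRAMING.  Object-search cell `pub-symmetroid`, door-A target `DoorA26 := PosRootLawAt 2 6 19`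
(stmt-ValiantsHypothesis-19979; OPEN, typed, never asserted).  Necessary-condition rows about the four-term WINDOWS of HYPOTHETICAL
Descartes-sharp fewnomials; nothing here bounds any census count, kills any cell or bears on `MatrixDescartes`
(stmt-ValiantsHypothesis-18050) / `VP ≠ VNP`.

KEY LEMMA (`fourNomial_exists_twist_zeros_of_three_le_countP`): if `g = a − bX^u + cX^(u+v) − eX^(u+v+w)` (`u,v,w ≥ 1`, `a,c,e > 0`)
has at least THREE positive roots counted with multiplicity, then the twist `Φ = u·g − X·g′` has zeros `0 < y₁ ≤ y₂` — the two critical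
points of `g/X^u` — on either side of the cusp abscissa (`w(v+w)e·y₁^S ≤ u(u+v)a ≤ w(v+w)e·y₂^S`, `S = u+v+w`) with `g(y₁) ≤ 0 ≤ g(y₂)`.
The degenerate configurations (double root = `y₁` or `y₂`, triple root = `y₁ = y₂ =` cusp) are included, which is what the census
currency `roots.countP` needs.  Proof: `Φ` is a trinomial, strictly decreasing then increasing about its centre
(`trinomial_strictAntiOn_Icc` / `trinomial_strictMonoOn_Ici`); if `Φ > 0` throughout, or `g(y₁) > 0`, or `g(y₂) < 0`, then every
positive root lies in an interval where `Φ > 0` and file I leaves at most one.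

[folklore] Intermediate value theorem + file I; elementary.
-/

-- `Summit.ValiantsHypothesis.ValiantsHypothesis.…` repeats a component by the D-0017 layout
-- (single-conjunct summit), which the `dupNamespace` linter flags; the name is mandated.
set_option linter.dupNamespace false

namespace Summit.ValiantsHypothesis.ValiantsHypothesis.Theorems.LacunarySymmetroidMatrixDescartes.Census

open Polynomial Finset Set
open scoped BigOperators Polynomial

/-- **The twist controls the monotonicity of `g/X^u`.**  On an interval `[p, q] ⊂ (0, ∞)` where `Φ = u·g − X·g′ ≤ 0` the
function `g(y)/y^u` is monotone (its derivative is `−Φ(y)/y^(u+1)`). [folklore] -/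
theorem fourNomial_div_pow_monotoneOn_of_twist_nonpos {u v w : ℕ} (hu : 0 < u) {a b c e p q : ℝ} (hp : 0 < p)
    (hΦ : ∀ y ∈ Icc p q, (u : ℝ) * a - (v : ℝ) * c * y ^ (u + v) + ((v : ℝ) + w) * e * y ^ (u + v + w) ≤ 0) :
    MonotoneOn (fun y : ℝ => (a - b * y ^ u + c * y ^ (u + v) - e * y ^ (u + v + w)) / y ^ u) (Icc p q) := by
  set P : ℝ[X] := C a - C b * X ^ u + C c * X ^ (u + v) - C e * X ^ (u + v + w) with hPdef
  have hfun : (fun y : ℝ => (a - b * y ^ u + c * y ^ (u + v) - e * y ^ (u + v + w)) / y ^ u)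
      = fun y => P.eval y / y ^ u := by
    funext y; rw [hPdef, eval_fourNomial]
  rw [hfun]
  set h' : ℝ → ℝ := fun y => ((derivative P).eval y * y ^ u - P.eval y * ((u : ℝ) * y ^ (u - 1))) / (y ^ u) ^ 2
    with hh'def
  refine monotoneOn_of_hasDerivWithinAt_nonneg (convex_Icc p q) (f' := h') ?_ ?_ ?_
  · refine ContinuousOn.div (P.continuous).continuousOn (by fun_prop) ?_
    intro y hy
    exact pow_ne_zero _ (hp.trans_le hy.1).ne'
  · intro y hy
    rw [interior_Icc] at hy
    have hy0 : y ≠ 0 := (hp.trans hy.1).ne'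
    exact ((Polynomial.hasDerivAt P y).div (hasDerivAt_pow u y) (pow_ne_zero _ hy0)).hasDerivWithinAt
  · intro y hy
    rw [interior_Icc] at hy
    have hy0 : 0 < y := hp.trans hy.1
    have hΦy := hΦ y ⟨hy.1.le, hy.2.le⟩
    have hpow : y * y ^ (u - 1) = y ^ u := by rw [← pow_succ', Nat.sub_add_cancel hu]
    have hsd : y * (derivative P).eval y
        = -(b * (u : ℝ) * y ^ u) + c * ((u : ℝ) + v) * y ^ (u + v) - e * ((u : ℝ) + v + w) * y ^ (u + v + w) := by
      rw [hPdef]; exact mul_eval_derivative_fourNomial a b c e u v w y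
    have hPy : P.eval y = a - b * y ^ u + c * y ^ (u + v) - e * y ^ (u + v + w) := by rw [hPdef, eval_fourNomial]
    have hyN : y * ((derivative P).eval y * y ^ u - P.eval y * ((u : ℝ) * y ^ (u - 1)))
        = -(y ^ u * ((u : ℝ) * a - (v : ℝ) * c * y ^ (u + v) + ((v : ℝ) + w) * e * y ^ (u + v + w))) := by
      calc y * ((derivative P).eval y * y ^ u - P.eval y * ((u : ℝ) * y ^ (u - 1)))
          = (y * (derivative P).eval y) * y ^ u - P.eval y * (u : ℝ) * (y * y ^ (u - 1)) := by ring
        _ = -(y ^ u * ((u : ℝ) * a - (v : ℝ) * c * y ^ (u + v) + ((v : ℝ) + w) * e * y ^ (u + v + w))) := by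
          rw [hpow, hsd, hPy]; ring
    have hnn : 0 ≤ y * ((derivative P).eval y * y ^ u - P.eval y * ((u : ℝ) * y ^ (u - 1))) := by
      rw [hyN, neg_nonneg]
      exact mul_nonpos_of_nonneg_of_nonpos (pow_pos hy0 u).le hΦy
    have hN : 0 ≤ (derivative P).eval y * y ^ u - P.eval y * ((u : ℝ) * y ^ (u - 1)) :=
      nonneg_of_mul_nonneg_right hnn hy0
    show 0 ≤ h' y
    exact div_nonneg hN (sq_nonneg _)

/-- **The twist controls the monotonicity of `g/X^u`.**  On an interval `[p, q] ⊂ (0, ∞)` where `Φ = u·g − X·g′ ≥ 0` the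
function `g(y)/y^u` is antitone. [folklore] -/
theorem fourNomial_div_pow_antitoneOn_of_twist_nonneg {u v w : ℕ} (hu : 0 < u) {a b c e p q : ℝ} (hp : 0 < p)
    (hΦ : ∀ y ∈ Icc p q, 0 ≤ (u : ℝ) * a - (v : ℝ) * c * y ^ (u + v) + ((v : ℝ) + w) * e * y ^ (u + v + w)) :
    AntitoneOn (fun y : ℝ => (a - b * y ^ u + c * y ^ (u + v) - e * y ^ (u + v + w)) / y ^ u) (Icc p q) := by
  -- apply the monotone version to the NEGATED 4-nomial `−a + bX^u − cX^(u+v) + eX^S`, whose twist is `−Φ`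
  have hm := fourNomial_div_pow_monotoneOn_of_twist_nonpos (u := u) (v := v) (w := w) hu (a := -a) (b := -b) (c := -c)
    (e := -e) hp (q := q) (by
      intro y hy
      have := hΦ y hy
      linarith)
  intro y hy y' hy' hyy'
  have h := hm hy hy' hyy'
  have e1 : (-a - -b * y ^ u + -c * y ^ (u + v) - -e * y ^ (u + v + w)) / y ^ u
      = -((a - b * y ^ u + c * y ^ (u + v) - e * y ^ (u + v + w)) / y ^ u) := by ring
  have e2 : (-a - -b * y' ^ u + -c * y' ^ (u + v) - -e * y' ^ (u + v + w)) / y' ^ u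
      = -((a - b * y' ^ u + c * y' ^ (u + v) - e * y' ^ (u + v + w)) / y' ^ u) := by ring
  have h' : (-a - -b * y ^ u + -c * y ^ (u + v) - -e * y ^ (u + v + w)) / y ^ u
      ≤ (-a - -b * y' ^ u + -c * y' ^ (u + v) - -e * y' ^ (u + v + w)) / y' ^ u := h
  rw [e1, e2] at h'
  exact neg_le_neg_iff.mp h'

/-- **KEY — the local-minimum / local-maximum characterisation of three positive roots, WITH MULTIPLICITY.**
`u, v, w ≥ 1`, `a, c, e > 0`.  If `g = a − bX^u + cX^(u+v) − eX^(u+v+w)` has at least three positive roots counted with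
multiplicity, then the Euler twist `Φ = u·g − X·g′ = u·a − v·c·X^(u+v) + (v+w)·e·X^(u+v+w)` (`= −X^(u+1)·(g/X^u)′`) has zeros
`0 < y₁ ≤ y₂` — the critical points of `g/X^u` — on either side of the cusp abscissa `y*`, `w(v+w)e·y₁^S ≤ u(u+v)a ≤ w(v+w)e·y₂^S`
(`S = u+v+w`), with `g(y₁) ≤ 0 ≤ g(y₂)` (the local minimum value of `g/X^u` is `≤ 0 ≤` its local maximum value).  Cases: if `Φ > 0`
throughout, or `g(y₁) > 0`, or `g(y₂) < 0`, all positive roots lie in an interval where `Φ > 0` and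
`fourNomial_countP_posRoots_le_one_of_twist_pos` leaves at most one. [folklore] -/
theorem fourNomial_exists_twist_zeros_of_three_le_countP {u v w : ℕ} (hu : 0 < u) (hv : 0 < v) (hw : 0 < w)
    {a b c e : ℝ} (ha : 0 < a) (hc : 0 < c) (he : 0 < e)
    (h3 : 3 ≤ (C a - C b * X ^ u + C c * X ^ (u + v) - C e * X ^ (u + v + w) : ℝ[X]).roots.countP (fun x => 0 < x)) :
    ∃ y₁ y₂ : ℝ, 0 < y₁ ∧ y₁ ≤ y₂ ∧
      (u : ℝ) * a - (v : ℝ) * c * y₁ ^ (u + v) + ((v : ℝ) + w) * e * y₁ ^ (u + v + w) = 0 ∧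
      (u : ℝ) * a - (v : ℝ) * c * y₂ ^ (u + v) + ((v : ℝ) + w) * e * y₂ ^ (u + v + w) = 0 ∧
      a - b * y₁ ^ u + c * y₁ ^ (u + v) - e * y₁ ^ (u + v + w) ≤ 0 ∧
      0 ≤ a - b * y₂ ^ u + c * y₂ ^ (u + v) - e * y₂ ^ (u + v + w) ∧
      (w : ℝ) * ((v : ℝ) + w) * e * y₁ ^ (u + v + w) ≤ (u : ℝ) * ((u : ℝ) + v) * a ∧
      (u : ℝ) * ((u : ℝ) + v) * a ≤ (w : ℝ) * ((v : ℝ) + w) * e * y₂ ^ (u + v + w) := by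
  classical
  set P : ℝ[X] := C a - C b * X ^ u + C c * X ^ (u + v) - C e * X ^ (u + v + w) with hPdef
  set Φ : ℝ → ℝ := fun y => (u : ℝ) * a - (v : ℝ) * c * y ^ (u + v) + ((v : ℝ) + w) * e * y ^ (u + v + w)
    with hΦdef
  set k : ℝ → ℝ := fun y => (a - b * y ^ u + c * y ^ (u + v) - e * y ^ (u + v + w)) / y ^ u with hkdef
  have hroot : ∀ x, P.IsRoot x ↔ a - b * x ^ u + c * x ^ (u + v) - e * x ^ (u + v + w) = 0 := by
    intro x; rw [IsRoot.def, hPdef, eval_fourNomial]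
  have hk_sign : ∀ y, 0 < y → (0 < k y ↔ 0 < a - b * y ^ u + c * y ^ (u + v) - e * y ^ (u + v + w)) := by
    intro y hy
    show 0 < (a - b * y ^ u + c * y ^ (u + v) - e * y ^ (u + v + w)) / y ^ u ↔ _
    rw [lt_div_iff₀ (pow_pos hy u), zero_mul]
  have hk_sign' : ∀ y, 0 < y → (k y < 0 ↔ a - b * y ^ u + c * y ^ (u + v) - e * y ^ (u + v + w) < 0) := by
    intro y hy
    show (a - b * y ^ u + c * y ^ (u + v) - e * y ^ (u + v + w)) / y ^ u < 0 ↔ _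
    rw [div_lt_iff₀ (pow_pos hy u), zero_mul]
  -- the centre `m` of `Φ`: ((v+w)(u+v+w)e)·m^w = v(u+v)c
  obtain ⟨m, hm, hmw⟩ := exists_pos_pow_eq
    (show 0 < (v : ℝ) * ((u : ℝ) + v) * c / (((v : ℝ) + w) * ((u : ℝ) + v + w) * e) by positivity) hw
  have hmeq : ((v : ℝ) + w) * ((u : ℝ) + v + w) * e * m ^ w = (v : ℝ) * ((u : ℝ) + v) * c := by
    rw [hmw]; field_simp
  have hqp : u + v + w - (u + v) = w := by omega
  have hantiΦ := trinomial_strictAntiOn_Icc (α := (u : ℝ) * a) (β := (v : ℝ) * c) (γ := ((v : ℝ) + w) * e)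
    (p := u + v) (q := u + v + w) (r := m) (by omega) (by omega) (by positivity)
    (le_of_eq (by rw [hqp]; push_cast; linear_combination hmeq))
  have hmonoΦ := trinomial_strictMonoOn_Ici (α := (u : ℝ) * a) (β := (v : ℝ) * c) (γ := ((v : ℝ) + w) * e)
    (p := u + v) (q := u + v + w) (r := m) (by omega) (by omega) (by positivity) hm
    (le_of_eq (by rw [hqp]; push_cast; linear_combination -1 * hmeq))
  by_cases hΦm : 0 < Φ m
  · -- CASE 1: `Φ > 0` on `(0, ∞)` ⇒ at most one positive root (with multiplicity)
    exfalso
    have hpos : ∀ y ∈ Ioi (0 : ℝ), 0 < Φ y := by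
      intro y hy
      have hy : 0 < y := hy
      rcases le_or_gt y m with hym | hym
      · have h : Φ m ≤ Φ y := hantiΦ.antitoneOn ⟨hy.le, hym⟩ ⟨hm.le, le_rfl⟩ hym
        exact hΦm.trans_le h
      · have h : Φ m ≤ Φ y := hmonoΦ.monotoneOn (self_mem_Ici) (hym.le : m ≤ y) hym.le
        exact hΦm.trans_le h
    have h1 : P.roots.countP (fun x => 0 < x) ≤ 1 :=
      fourNomial_countP_posRoots_le_one_of_twist_pos (v := v) (w := w) (b := b) (c := c) (e := e) hu ha.ne'
        (Ioi 0) ordConnected_Ioi (fun x hx _ => hx) hpos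
    omega
  · push Not at hΦm
    -- CASE 2: `Φ(m) ≤ 0`: zeros `y₁ ∈ (0, m]` and `y₂ ∈ [m, Y]`
    have hcontΦ : Continuous Φ := by rw [hΦdef]; fun_prop
    have hΦ0 : 0 < Φ 0 := by
      simp only [hΦdef, zero_pow (by omega : u + v ≠ 0), zero_pow (by omega : u + v + w ≠ 0), mul_zero,
        sub_zero, add_zero]
      positivity
    obtain ⟨y₁, hy₁m, hy₁0⟩ : ∃ y₁ ∈ Icc (0 : ℝ) m, Φ y₁ = 0 :=
      intermediate_value_Icc' hm.le hcontΦ.continuousOn ⟨hΦm, hΦ0.le⟩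
    have hy₁ : 0 < y₁ := by
      rcases hy₁m.1.eq_or_lt with h | h
      · rw [← h] at hy₁0; linarith
      · exact h
    -- an explicit point `Y ≥ m` with `Φ(Y) > 0`
    set Y : ℝ := 1 + (v : ℝ) * c / (((v : ℝ) + w) * e) with hYdef
    have hY1 : 1 ≤ Y := by
      have h0 : 0 ≤ (v : ℝ) * c / (((v : ℝ) + w) * e) := by positivity
      linarith [hYdef]
    have hY0 : 0 < Y := by linarith
    have hYw : (v : ℝ) * c ≤ ((v : ℝ) + w) * e * Y ^ w := by
      have h1 : (v : ℝ) * c ≤ ((v : ℝ) + w) * e * Y := by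
        have hYe : ((v : ℝ) + w) * e * Y = ((v : ℝ) + w) * e + (v : ℝ) * c := by
          rw [hYdef]; field_simp
        have : 0 ≤ ((v : ℝ) + w) * e := by positivity
        linarith
      have h2 : Y ≤ Y ^ w := by
        calc Y = Y ^ 1 := (pow_one Y).symm
          _ ≤ Y ^ w := pow_le_pow_right₀ hY1 hw
      have : 0 ≤ ((v : ℝ) + w) * e := by positivity
      nlinarith
    have hΦY : 0 < Φ Y := by
      have hYuv : 0 < Y ^ (u + v) := pow_pos hY0 _
      have hsplit : Y ^ (u + v + w) = Y ^ (u + v) * Y ^ w := pow_add Y (u + v) w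
      have : (v : ℝ) * c * Y ^ (u + v) ≤ ((v : ℝ) + w) * e * Y ^ (u + v + w) := by
        rw [hsplit]; nlinarith
      show 0 < (u : ℝ) * a - (v : ℝ) * c * Y ^ (u + v) + ((v : ℝ) + w) * e * Y ^ (u + v + w)
      have hua : 0 < (u : ℝ) * a := by positivity
      linarith
    have hmY : m ≤ Y := by
      have hlt : m ^ w < Y ^ w := by
        have h1 : ((v : ℝ) + w) * ((u : ℝ) + v + w) * e * m ^ w < ((v : ℝ) + w) * ((u : ℝ) + v + w) * e * Y ^ w := by
          rw [hmeq]
          have huvw : (v : ℝ) * ((u : ℝ) + v) * c < (v : ℝ) * ((u : ℝ) + v + w) * c := by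
            have : (0 : ℝ) < (v : ℝ) * c * w := by positivity
            nlinarith
          have : (v : ℝ) * ((u : ℝ) + v + w) * c ≤ ((v : ℝ) + w) * ((u : ℝ) + v + w) * e * Y ^ w := by
            have := mul_le_mul_of_nonneg_left hYw (show (0 : ℝ) ≤ (u : ℝ) + v + w by positivity)
            nlinarith
          linarith
        exact lt_of_mul_lt_mul_left h1 (by positivity)
      exact (lt_of_pow_lt_pow_left' hY0.le w hlt).le
    obtain ⟨y₂, hy₂m, hy₂0⟩ : ∃ y₂ ∈ Icc m Y, Φ y₂ = 0 :=
      intermediate_value_Icc hmY hcontΦ.continuousOn ⟨hΦm, hΦY.le⟩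
    have hy₁y₂ : y₁ ≤ y₂ := hy₁m.2.trans hy₂m.1
    have hy₂ : 0 < y₂ := hy₁.trans_le hy₁y₂
    -- signs of Φ: `> 0` on `(0, y₁)` and `(y₂, ∞)`, `≤ 0` on `[y₁, y₂]`
    have hΦleft : ∀ y, 0 < y → y < y₁ → 0 < Φ y := by
      intro y hy hyy
      have h : Φ y₁ < Φ y := hantiΦ ⟨hy.le, hyy.le.trans hy₁m.2⟩ hy₁m hyy
      rwa [hy₁0] at h
    have hΦright : ∀ y, y₂ < y → 0 < Φ y := by
      intro y hyy
      have h : Φ y₂ < Φ y := hmonoΦ (hy₂m.1 : m ≤ y₂) (hy₂m.1.trans hyy.le : m ≤ y) hyy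
      rwa [hy₂0] at h
    have hΦmid : ∀ y ∈ Icc y₁ y₂, Φ y ≤ 0 := by
      intro y hy
      rcases le_or_gt y m with hym | hym
      · have h : Φ y ≤ Φ y₁ := hantiΦ.antitoneOn ⟨hy₁.le, hy₁m.2⟩ ⟨hy₁.le.trans hy.1, hym⟩ hy.1
        rwa [hy₁0] at h
      · have h : Φ y ≤ Φ y₂ := hmonoΦ.monotoneOn (hym.le : m ≤ y) (hy₂m.1 : m ≤ y₂) hy.2
        rwa [hy₂0] at h
    -- the cusp inequalities
    have hpw₁ : y₁ ^ (u + v + w) = y₁ ^ (u + v) * y₁ ^ w := pow_add y₁ (u + v) w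
    have hpw₂ : y₂ ^ (u + v + w) = y₂ ^ (u + v) * y₂ ^ w := pow_add y₂ (u + v) w
    have hcusp₁ : (w : ℝ) * ((v : ℝ) + w) * e * y₁ ^ (u + v + w) ≤ (u : ℝ) * ((u : ℝ) + v) * a := by
      have h1 : y₁ ^ w ≤ m ^ w := pow_le_pow_left₀ hy₁.le hy₁m.2 w
      have h2 : ((v : ℝ) + w) * ((u : ℝ) + v + w) * e * y₁ ^ w ≤ (v : ℝ) * ((u : ℝ) + v) * c := by
        rw [← hmeq]; exact mul_le_mul_of_nonneg_left h1 (by positivity)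
      have h3 := mul_le_mul_of_nonneg_right h2 (pow_pos hy₁ (u + v)).le
      have hz : (u : ℝ) * a - (v : ℝ) * c * y₁ ^ (u + v) + ((v : ℝ) + w) * e * y₁ ^ (u + v + w) = 0 := hy₁0
      rw [hpw₁] at hz ⊢
      linear_combination h3 - ((u : ℝ) + v) * hz
    have hcusp₂ : (u : ℝ) * ((u : ℝ) + v) * a ≤ (w : ℝ) * ((v : ℝ) + w) * e * y₂ ^ (u + v + w) := by
      have h1 : m ^ w ≤ y₂ ^ w := pow_le_pow_left₀ hm.le hy₂m.1 w
      have h2 : (v : ℝ) * ((u : ℝ) + v) * c ≤ ((v : ℝ) + w) * ((u : ℝ) + v + w) * e * y₂ ^ w := by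
        rw [← hmeq]; exact mul_le_mul_of_nonneg_left h1 (by positivity)
      have h3 := mul_le_mul_of_nonneg_right h2 (pow_pos hy₂ (u + v)).le
      have hz : (u : ℝ) * a - (v : ℝ) * c * y₂ ^ (u + v) + ((v : ℝ) + w) * e * y₂ ^ (u + v + w) = 0 := hy₂0
      rw [hpw₂] at hz ⊢
      linear_combination h3 + ((u : ℝ) + v) * hz
    -- monotonicity of k = g/X^u on the three pieces
    have hk_anti_left : ∀ x, 0 < x → x ≤ y₁ → k y₁ ≤ k x := by
      intro x hx hxy
      have hant := fourNomial_div_pow_antitoneOn_of_twist_nonneg (v := v) (w := w) (a := a) (b := b) (c := c) (e := e)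
        hu hx (q := y₁) (by
          intro y hy
          rcases hy.2.eq_or_lt with h | h
          · rw [h]; exact le_of_eq hy₁0.symm
          · exact (hΦleft y (hx.trans_le hy.1) h).le)
      exact hant ⟨le_rfl, hxy⟩ ⟨hxy, le_rfl⟩ hxy
    have hk_mono_mid : MonotoneOn k (Icc y₁ y₂) :=
      fourNomial_div_pow_monotoneOn_of_twist_nonpos (v := v) (w := w) (a := a) (b := b) (c := c) (e := e) hu hy₁ hΦmid
    have hk_anti_right : ∀ x, y₂ ≤ x → k x ≤ k y₂ := by
      intro x hxy
      have hant := fourNomial_div_pow_antitoneOn_of_twist_nonneg (v := v) (w := w) (a := a) (b := b) (c := c) (e := e)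
        hu hy₂ (q := x) (by
          intro y hy
          rcases hy.1.eq_or_lt with h | h
          · rw [← h]; exact le_of_eq hy₂0.symm
          · exact (hΦright y h).le)
      exact hant ⟨le_rfl, hxy⟩ ⟨hxy, le_rfl⟩ hxy
    by_cases hg₁ : a - b * y₁ ^ u + c * y₁ ^ (u + v) - e * y₁ ^ (u + v + w) ≤ 0
    · by_cases hg₂ : 0 ≤ a - b * y₂ ^ u + c * y₂ ^ (u + v) - e * y₂ ^ (u + v + w)
      · exact ⟨y₁, y₂, hy₁, hy₁y₂, hy₁0, hy₂0, hg₁, hg₂, hcusp₁, hcusp₂⟩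
      · -- CASE 2b: `g(y₂) < 0` ⇒ `g < 0` on `[y₁, ∞)`, all positive roots in `(0, y₁)` where `Φ > 0`
        exfalso
        push Not at hg₂
        have hk₂ : k y₂ < 0 := (hk_sign' y₂ hy₂).mpr hg₂
        have hroots : ∀ x, 0 < x → P.IsRoot x → x ∈ Ioo 0 y₁ := by
          intro x hx hr
          refine ⟨hx, ?_⟩
          by_contra hxy
          push Not at hxy
          have hkx : k x < 0 := by
            rcases le_or_gt x y₂ with hx₂ | hx₂
            · exact (hk_mono_mid ⟨hxy, hx₂⟩ ⟨hy₁y₂, le_rfl⟩ hx₂).trans_lt hk₂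
            · exact (hk_anti_right x hx₂.le).trans_lt hk₂
          have hgx : a - b * x ^ u + c * x ^ (u + v) - e * x ^ (u + v + w) < 0 := (hk_sign' x hx).mp hkx
          have := (hroot x).mp hr
          linarith
        have h1 : P.roots.countP (fun x => 0 < x) ≤ 1 :=
          fourNomial_countP_posRoots_le_one_of_twist_pos (v := v) (w := w) (b := b) (c := c) (e := e) hu ha.ne'
            (Ioo 0 y₁) ordConnected_Ioo hroots (fun y hy => hΦleft y hy.1 hy.2)
        omega
    · -- CASE 2a: `g(y₁) > 0` ⇒ `g > 0` on `(0, y₂]`, all positive roots in `(y₂, ∞)` where `Φ > 0`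
      exfalso
      push Not at hg₁
      have hk₁ : 0 < k y₁ := (hk_sign y₁ hy₁).mpr hg₁
      have hroots : ∀ x, 0 < x → P.IsRoot x → x ∈ Ioi y₂ := by
        intro x hx hr
        show y₂ < x
        by_contra hxy
        push Not at hxy
        have hkx : 0 < k x := by
          rcases le_or_gt x y₁ with hx₁ | hx₁
          · exact hk₁.trans_le (hk_anti_left x hx hx₁)
          · exact hk₁.trans_le (hk_mono_mid ⟨le_rfl, hy₁y₂⟩ ⟨hx₁.le, hxy⟩ hx₁.le)
        have hgx : 0 < a - b * x ^ u + c * x ^ (u + v) - e * x ^ (u + v + w) := (hk_sign x hx).mp hkx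
        have := (hroot x).mp hr
        linarith
      have h1 : P.roots.countP (fun x => 0 < x) ≤ 1 :=
        fourNomial_countP_posRoots_le_one_of_twist_pos (v := v) (w := w) (b := b) (c := c) (e := e) hu ha.ne'
          (Ioi y₂) ordConnected_Ioi hroots (fun y hy => hΦright y hy)
      omega

end Summit.ValiantsHypothesis.ValiantsHypothesis.Theorems.LacunarySymmetroidMatrixDescartes.Census
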